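import Summits.NavierStokesRegularity.FluidComputer.DesignSpectralRadius

/-!
# DesignSliceCertificate — what finitely many measured Reynolds SLICES of the design sequence exclude
# (FLUID COMPUTER cell, idea-1 gen 19 v3; zero compute; companion of `DesignSpectralRadius.lean`)

HONEST FRAMING: low prior, high value-of-information experiment on Tao's machine paradigm;
NOT a claim that NS blows up.

`DesignSpectralRadius.lean` proves the ONE-WINDOW KILL from the GLOBAL design sequence
`design Φ k = sup_v cumLog Φ v k`: `design k < k·log λ` at one depth excludes every (eventual) machine.
The cell, however, measures `Q_k⋆` on SLICES of the manifold — seeds at a fixed band Reynolds number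
(`Re₀`: `Q₂⋆ = 1.945` @ 192³; `3Re₀`: STAGE 2, in flight) — never the global supremum.  This file types
exactly what such a slice certificate buys, with the kill taken as a hypothesis on a SUB-LEVEL SET
`{w | Re w ≤ Rmax}` of an arbitrary Reynolds functional `Re : X → ℝ` (no Reynolds law is needed):

* `exists_subfloor_of_cumLog_lt`: pointwise window kill — if the state at level `n` has `k`-level cumulative
  log-gain `< k·log λ`, some level of `[n, n+k)` is below the floor.
* `sublevel_kill_of_bound`: the MONOTONE-DESIGN bridge, typed — a bound `D < k·log λ` on `cumLog` over the whole
  sub-level set (what a measured TOP slice gives if `Q_k⋆(R)` is non-decreasing in `R`) is a sub-level kill;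
  the monotonicity is a hypothesis of the reading, never assumed silently.
* `no_machine_of_sublevel_kill`: no machine STARTS at `Re ≤ Rmax`.
* `eventual_machine_stays_above` (the EXCLUSION ZONE): an eventual machine runs strictly ABOVE `Rmax` at
  every level from its onset on — a machine, if any, lives entirely outside the certified Reynolds range,
  and the zone widens with every certified slice.
* `no_eventual_machine_of_certificate`: a monotone one-level gain envelope `gain ≤ γ(Re)` with `γ(Rc) < λ`
  (the TRAPDOOR range `{Re ≤ Rc}`, cf. `ReynoldsLaw.trapdoor`) plus a depth-`k` kill on `{Rc < Re}` excludes
  every eventual machine from every seed; `eventual_machine_escapes_of_certificate`: with the kill only on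
  `{Rc < Re ≤ Rmax}` (finitely many slices), every eventual machine runs above `Rmax`.

Cell reading (`pub-fluidc-idea-1/DESIGN-RADIUS.md` §7, `atlas/IDEA-1.md` §23): after STAGE 2 the negative
sentence of record is "every eventual machine on the band34 manifold runs entirely above `3Re₀`" (modulo
globality of the two relay optima and the monotone-design bridge below each measured slice; below the
extrapolated trapdoor `R_c ≈ 0.056 Re₀` the envelope closes it); pre-registration P-G19-1 (`PREREG-R2.md` §10bf).
0 sorry; elementary.  Staged by planner seat pub-fluidc-idea-1 gen 19
(HOME/pub-fluidc-idea-1/lean/DesignSliceCertificate.lean); intended home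
`Summits/NavierStokesRegularity/FluidComputer/DesignSliceCertificate.lean` (filing is the literature seat's call).
Filed by `pub-fluidc-lit` gen 45 (LEAN ASK #12b, HOME/STATUS.md l.4782; staged sha16 `0aa9f94c54d9c92b`, 121 l.): statements/proofs byte-identical, this line added.
-/

open Filter Topology Function Finset

namespace Summit.NavierStokesRegularity.FluidComputer.DesignSpectralRadius

open RGFixedPoint

variable {X : Type*} {Φ : LevelMap X}

section SliceCertificate

variable {Re : X → ℝ}

/-- Pointwise window kill: if the state at level `n` has `k`-level cumulative log-gain below `k·log λ`,
some level of the window `[n, n+k)` is below the floor. -/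
theorem exists_subfloor_of_cumLog_lt {v : X} {n k : ℕ}
    (h : cumLog Φ (Φ.M^[n] v) k < k * Real.log Φ.lam) : ∃ i < k, Φ.levelRatio v (n + i) < 1 := by
  by_contra hcon
  have hfloor : ∀ i < k, 1 ≤ Φ.levelRatio v (n + i) := fun i hi =>
    not_lt.mp fun hlt => hcon ⟨i, hi, hlt⟩
  have h1 := window_le_cumLog hfloor
  linarith

/-- A bound `D < k·log λ` on the `k`-level cumulative log-gain of EVERY state of the sub-level set
`{Re ≤ Rmax}` (what a measured top slice gives under the monotone-design hypothesis) is a sub-level kill. -/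
theorem sublevel_kill_of_bound {Rmax D : ℝ} {k : ℕ}
    (hbound : ∀ w, Re w ≤ Rmax → cumLog Φ w k ≤ D) (hD : D < k * Real.log Φ.lam) :
    ∀ w, Re w ≤ Rmax → cumLog Φ w k < k * Real.log Φ.lam :=
  fun w hw => (hbound w hw).trans_lt hD

/-- SUB-LEVEL KILL ⇒ no machine STARTS at or below `Rmax`. -/
theorem no_machine_of_sublevel_kill {Rmax : ℝ} {k : ℕ}
    (hkill : ∀ w, Re w ≤ Rmax → cumLog Φ w k < k * Real.log Φ.lam) {v : X} (hv : Re v ≤ Rmax) :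
    ¬ (∀ n, 1 ≤ Φ.levelRatio v n) := by
  intro hmach
  have h0 : cumLog Φ (Φ.M^[0] v) k < k * Real.log Φ.lam := by simpa using hkill v hv
  obtain ⟨i, -, hi⟩ := exists_subfloor_of_cumLog_lt h0
  exact absurd (hmach (0 + i)) (not_le.mpr hi)

/-- ESCAPE (the exclusion zone): under a sub-level kill on `{Re ≤ Rmax}`, an EVENTUAL machine is strictly
above `Rmax` at every level from its onset on — a machine, if any, lives entirely outside the certified
Reynolds range. -/
theorem eventual_machine_stays_above {Rmax : ℝ} {k : ℕ}
    (hkill : ∀ w, Re w ≤ Rmax → cumLog Φ w k < k * Real.log Φ.lam) {v : X} {n₀ : ℕ}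
    (hmach : ∀ n, n₀ ≤ n → 1 ≤ Φ.levelRatio v n) {n : ℕ} (hn : n₀ ≤ n) :
    Rmax < Re (Φ.M^[n] v) := by
  by_contra hle
  obtain ⟨i, -, hi⟩ := exists_subfloor_of_cumLog_lt (hkill _ (not_lt.mp hle))
  exact absurd (hmach (n + i) (le_trans hn (Nat.le_add_right n i))) (not_le.mpr hi)

/-- FULL CERTIFICATE: a monotone one-level envelope `gain ≤ γ(Re)` with `γ(Rc) < λ` (the trapdoor range
`{Re ≤ Rc}`) together with a depth-`k` kill on `{Rc < Re}` excludes every EVENTUAL machine from every seed. -/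
theorem no_eventual_machine_of_certificate {γ : ℝ → ℝ} {Rc : ℝ} {k : ℕ} (hγ : Monotone γ)
    (henv : ∀ w, Φ.gain w ≤ γ (Re w)) (hRc : γ Rc < Φ.lam)
    (hkill : ∀ w, Rc < Re w → cumLog Φ w k < k * Real.log Φ.lam) (v : X) :
    ¬ (∀ᶠ n in atTop, 1 ≤ Φ.levelRatio v n) := by
  intro hev
  obtain ⟨n₀, hn₀⟩ := eventually_atTop.mp hev
  by_cases hlow : Re (Φ.M^[n₀] v) ≤ Rc
  · have hlt : Φ.levelRatio v n₀ < 1 :=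
      (levelRatio_lt_one_iff Φ).mpr (lt_of_le_of_lt ((henv _).trans (hγ hlow)) hRc)
    exact absurd (hn₀ n₀ le_rfl) (not_le.mpr hlt)
  · obtain ⟨i, -, hi⟩ := exists_subfloor_of_cumLog_lt (hkill _ (not_le.mp hlow))
    exact absurd (hn₀ (n₀ + i) (Nat.le_add_right n₀ i)) (not_le.mpr hi)

/-- The same certificate with the kill only up to `Rmax` (finitely many slices): every eventual machine
runs above `Rmax` from its onset — what the cell's record says after each certified slice. -/
theorem eventual_machine_escapes_of_certificate {γ : ℝ → ℝ} {Rc Rmax : ℝ} {k : ℕ} (hγ : Monotone γ)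
    (henv : ∀ w, Φ.gain w ≤ γ (Re w)) (hRc : γ Rc < Φ.lam)
    (hkill : ∀ w, Rc < Re w → Re w ≤ Rmax → cumLog Φ w k < k * Real.log Φ.lam) {v : X} {n₀ : ℕ}
    (hmach : ∀ n, n₀ ≤ n → 1 ≤ Φ.levelRatio v n) {n : ℕ} (hn : n₀ ≤ n) :
    Rmax < Re (Φ.M^[n] v) := by
  by_contra hle
  by_cases hlow : Re (Φ.M^[n] v) ≤ Rc
  · have hlt : Φ.levelRatio v n < 1 :=
      (levelRatio_lt_one_iff Φ).mpr (lt_of_le_of_lt ((henv _).trans (hγ hlow)) hRc)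
    exact absurd (hmach n hn) (not_le.mpr hlt)
  · obtain ⟨i, -, hi⟩ := exists_subfloor_of_cumLog_lt (hkill _ (not_le.mp hlow) (not_lt.mp hle))
    exact absurd (hmach (n + i) (le_trans hn (Nat.le_add_right n i))) (not_le.mpr hi)

end SliceCertificate

end Summit.NavierStokesRegularity.FluidComputer.DesignSpectralRadius
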